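import Summits.CriticalPhenomena.Ising3DConformalLimit.Theses.EnergyNotSigmaSquared
import Summits.CriticalPhenomena.Ising3DConformalLimit.Theses.HyperoctahedralRP
import Summits.CriticalPhenomena.Ising3DConformalLimit.Theses.LogPolarProxy
import Literature.Probability.LatticeModels.CriticalScalingDimension

/-!
# Sketch — crux-ideate for `MoebiusLimitExists` (item stmt-CriticalPhenomena-1344), ideator k = 2

First lemmas of the two idea cards `one-map-one-jet` (analytic rigidity: Möbius covariance is
decided by the inversion jet at ONE cospherical configuration; first order = equal radial weights)
and `gaussian-endpoint-light-window` (Δ = 1/2 branch by Jost–Schroer–Pohlmeyer, Δ ∈ (1/2,1]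
branch = light-scalar rigidity), plus the kernel-checked compositions concluding the crux BY NAME
(`Theses.EnergyNotSigmaSquared.MoebiusLimit`, the route decl of item 1344).
-/

noncomputable section

open Literature.Probability.LatticeModels EuclideanGeometry

namespace Summit.CriticalPhenomena.Ising3DConformalLimit.Cruxes.MoebiusLimitExists.IdeatorK2

/-- Points of `ℝ³`. -/
abbrev E3 : Type := EuclideanSpace ℝ (Fin 3)

/-! ## Card 1 — one map, one jet -/

/-- The inversion defect of a family: `S n (ι x) − (∏ ‖x i‖^{2Δ}) · S n x`. -/
def inversionDefect (Δ : ℝ) (S : CorrFamily 3) (n : ℕ) (x : Fin n → E3) : ℝ :=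
  S n (fun i => inversion 0 1 (x i)) - (∏ i, ‖x i‖ ^ (2 * Δ)) * S n x

/-- Non-coincident configurations avoiding the pole of the unit inversion. -/
def PuncturedNonCoincident (n : ℕ) : Set (Fin n → E3) :=
  {x | x ∈ NonCoincident 3 n ∧ ∀ i, x i ≠ 0}

/-- (J) ANALYTIC JET REDUCTION (provable, M): for a family analytic on the non-coincident set and
normalised off it, vanishing of the inversion defect to infinite order at ONE punctured
non-coincident configuration (per `n`) is already full inversion covariance. Ingredients: `ι` is
real-analytic off `0`, `PuncturedNonCoincident n` is connected (`d = 3`: complement of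
codimension-3 subspaces), identity theorem `AnalyticOnNhd.eqOn_zero_of_preconnected_of_eventuallyEq_zero`,
and on non-injective `x` both sides vanish by normalisation. -/
def OnePointJetReduction : Prop :=
  ∀ (Δ : ℝ) (S : CorrFamily 3),
    (∀ n, AnalyticOnNhd ℝ (S n) (NonCoincident 3 n)) →
    (∀ n z, z ∉ NonCoincident 3 n → S n z = 0) →
    (∀ n, ∃ x₀ ∈ PuncturedNonCoincident n,
        HasFPowerSeriesAt (inversionDefect Δ S n)
          (0 : FormalMultilinearSeries ℝ (Fin n → E3) ℝ) x₀) →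
    IsInversionCovariant Δ S

/-- (E) EQUAL RADIAL WEIGHTS ON THE FIXED SPHERE: for configurations on the unit sphere (the fixed
locus of `ι`) the derivative of `S n` along the radial displacement of the SINGLE point `i`
equals `−Δ · S n` — for each `i` separately (their sum is the scale Ward identity). -/
def EqualRadialWeights (Δ : ℝ) (S : CorrFamily 3) : Prop :=
  ∀ n (x : Fin n → E3), x ∈ NonCoincident 3 n → (∀ i, ‖x i‖ = 1) →
    DifferentiableAt ℝ (S n) x →
    ∀ i, fderiv ℝ (S n) x (Pi.single i (x i)) = -Δ * S n x

/-- First order of the jet criterion (provable, S/M: differentiate `S n (ι x) = (∏‖x i‖^{2Δ}) S n x`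
at the fixed sphere; `dι` there is the tangent-plane reflection). -/
def InversionForcesEqualRadialWeights : Prop :=
  ∀ (Δ : ℝ) (S : CorrFamily 3), IsInversionCovariant Δ S →
    (∀ n, ∀ x ∈ PuncturedNonCoincident n, DifferentiableAt ℝ (S n) x) →
    EqualRadialWeights Δ S

/-- Circumradial form (all cospherical quadruples): derivative of `S 4` along the displacement of
point `i` away from the circumcentre `a` equals `−Δ · S 4`. -/
def CircumradialLawFour (Δ : ℝ) (S : CorrFamily 3) : Prop :=
  ∀ (a : E3) (r : ℝ), 0 < r → ∀ x : Fin 4 → E3, x ∈ NonCoincident 3 4 →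
    (∀ i, dist (x i) a = r) → DifferentiableAt ℝ (S 4) x →
    ∀ i, fderiv ℝ (S 4) x (Pi.single i (x i - a)) = -Δ * S 4 x

/-- (C4) At `n = 4` the circumradial law IS Möbius covariance (given similarity covariance and
analyticity): the four single-point circumradial fields together with the seven similarity fields
span the 10-dimensional Möbius orbit tangent at a generic quadruple (rank check 7 → 10 done
numerically, `radial_law_check.py`), so `S 4 ·(prefactor)⁻¹` is locally constant on orbits. -/
def CircumradialCharacterisesFour : Prop :=
  ∀ (Δ : ℝ) (S : CorrFamily 3), 0 < Δ →
    AnalyticOnNhd ℝ (S 4) (NonCoincident 3 4) → (∀ z, z ∉ NonCoincident 3 4 → S 4 z = 0) →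
    IsTranslationInvariant S → IsRotationInvariant S → IsScaleCovariant Δ S →
    CircumradialLawFour Δ S →
    ∀ x : Fin 4 → E3, (∀ i, x i ≠ 0) →
      S 4 (fun i => inversion 0 1 (x i)) = (∏ i, ‖x i‖ ^ (2 * Δ)) * S 4 x

/-- The nine lattice mirror normals `e_i`, `e_i ± e_j` (the `B₃` arrangement). -/
def mirrorNormals : Set E3 :=
  {v | ∃ i j : Fin 3, i ≠ j ∧ (v = EuclideanSpace.single i 1 ∨
      v = EuclideanSpace.single i 1 + EuclideanSpace.single j 1 ∨
      v = EuclideanSpace.single i 1 - EuclideanSpace.single j 1)}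

/-- Good configurations: non-coincident, and three linearly independent mirror normals along each of
which the `n` projections are pairwise distinct (complement of codimension ≥ 2 in `NonCoincident`,
since at most four of the nine normals are coplanar). -/
def GoodConfig (n : ℕ) : Set (Fin n → E3) :=
  {x | x ∈ NonCoincident 3 n ∧ ∃ v : Fin 3 → E3, LinearIndependent ℝ v ∧ (∀ a, v a ∈ mirrorNormals) ∧
      ∀ a, Function.Injective (fun i => inner ℝ (x i) (v a))}

/-- (A) NINE-MIRROR ANALYTICITY (provable, L): every normalised, translation-invariant,
scale-covariant pointwise scaling limit of the critical `ℤ³` correlators that is continuous off the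
diagonals is real-analytic on the good configurations. Route: lattice reflection positivity in the
nine mirrors passes to the limit ⇒ Osterwalder–Schrader contraction semigroup in each mirror
direction ⇒ holomorphic extension in that direction's ordered time gaps ⇒ joint real-analyticity by
the separate-analyticity (Bernstein–Siciak / Jarnicki–Pflug cross) theorem in three independent
directions. -/
def NineMirrorAnalyticity : Prop :=
  ∀ (ρ : ℝ → ℝ) (Δ : ℝ) (S : CorrFamily 3), (∀ δ ∈ Set.Ioc (0:ℝ) 1, 0 < ρ δ) →
    HasPointwiseScalingLimit (criticalCorr 3) ρ S →
    (∀ n z, z ∉ NonCoincident 3 n → S n z = 0) →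
    IsTranslationInvariant S → IsScaleCovariant Δ S →
    (∀ n, ContinuousOn (S n) (NonCoincident 3 n)) →
    ∀ n, AnalyticOnNhd ℝ (S n) (GoodConfig n)

/-- (A⁺) The regularity stub the line consumes: analyticity on ALL of `NonCoincident` (= (A) plus
removal of the codimension-2 exceptional set, e.g. by the mirror-Hölder equicontinuity of route
MirrorHoelderCompactness). -/
def LimitAnalyticity : Prop :=
  ∀ (ρ : ℝ → ℝ) (Δ : ℝ) (S : CorrFamily 3), (∀ δ ∈ Set.Ioc (0:ℝ) 1, 0 < ρ δ) →
    HasPointwiseScalingLimit (criticalCorr 3) ρ S →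
    (∀ n z, z ∉ NonCoincident 3 n → S n z = 0) →
    IsTranslationInvariant S → IsScaleCovariant Δ S →
    ∀ n, AnalyticOnNhd ℝ (S n) (NonCoincident 3 n)

/-- (V) THE RESIDUAL CRUX OF CARD 1 — the inversion jet vanishes at one punctured configuration
(per `n`) for every normalised scale-covariant limit of the critical correlators. Order 0 is free
on the fixed sphere; order 1 there is `EqualRadialWeights`. -/
def InversionJetVanishes : Prop :=
  ∀ (ρ : ℝ → ℝ) (Δ : ℝ) (S : CorrFamily 3), (∀ δ ∈ Set.Ioc (0:ℝ) 1, 0 < ρ δ) →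
    HasPointwiseScalingLimit (criticalCorr 3) ρ S →
    (∀ n z, z ∉ NonCoincident 3 n → S n z = 0) → IsNondegenerateTwoPoint S →
    IsTranslationInvariant S → IsScaleCovariant Δ S →
    ∀ n, ∃ x₀ ∈ PuncturedNonCoincident n,
      HasFPowerSeriesAt (inversionDefect Δ S n) (0 : FormalMultilinearSeries ℝ (Fin n → E3) ℝ) x₀

/-- Card 1 concludes the crux BY NAME: existence (shared item 1981) + analyticity + jet vanishing +
jet reduction + the thin-form group lemma (item 4585) ⇒ `MoebiusLimit` (item 1344). Pure logic. -/
theorem moebiusLimit_of_jet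
    (hE : Theses.HyperoctahedralRP.ExistsScaleCovariantLimit)
    (hA : LimitAnalyticity) (hV : InversionJetVanishes) (hJ : OnePointJetReduction)
    (hG : Theses.LogPolarProxy.MoebiusFromTranslationsAndInversion) :
    Theses.EnergyNotSigmaSquared.MoebiusLimit := by
  obtain ⟨ρ, Δ, S, hρ, hΔ, hlim, hnorm, hnd, htr, hsc⟩ := hE
  have han : ∀ n, AnalyticOnNhd ℝ (S n) (NonCoincident 3 n) := hA ρ Δ S hρ hlim hnorm htr hsc
  have hinv : IsInversionCovariant Δ S :=
    hJ Δ S han hnorm (hV ρ Δ S hρ hlim hnorm hnd htr hsc)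
  have hcont : ∀ n, ContinuousOn (S n) (NonCoincident 3 n) := fun n => (han n).continuousOn
  exact ⟨ρ, Δ, S, hρ, hΔ, hlim, hnd, hG Δ S hΔ hnorm hcont htr hsc hinv⟩

/-! ## Card 2 — Gaussian endpoint + light window -/

/-- Reflection positivity of a WHOLE family across the mirror `nrm^⊥` (finite sums of products of
insertions in the open half-space `⟨·, nrm⟩ > 0`). -/
def IsFamilyRP (S : CorrFamily 3) (nrm : E3) : Prop :=
  ∀ (m : ℕ) (deg : Fin m → ℕ) (pts : (k : Fin m) → Fin (deg k) → E3) (c : Fin m → ℝ),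
    (∀ k j, 0 < inner ℝ (pts k j) nrm) →
    0 ≤ ∑ k, ∑ l, c k * c l *
      S (deg k + deg l)
        (Fin.addCases (fun j => ((ℝ ∙ nrm)ᗮ).reflection (pts k j)) (fun j => pts l j))

/-- (P) support: nine-mirror reflection positivity of the critical `ℤ³` correlators passes to every
normalised pointwise scaling limit (closed condition; the lattice RP is
`isingTorus_reflectionPositive_sites/_bonds` + diagonal planes, Fröhlich–Israel–Lieb–Simon). -/
def LimitNineMirrorRP : Prop :=
  ∀ (ρ : ℝ → ℝ) (S : CorrFamily 3), (∀ δ ∈ Set.Ioc (0:ℝ) 1, 0 < ρ δ) →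
    HasPointwiseScalingLimit (criticalCorr 3) ρ S →
    (∀ n z, z ∉ NonCoincident 3 n → S n z = 0) →
    ∀ nrm ∈ mirrorNormals, IsFamilyRP S nrm

/-- OS-type regularity of a family: permutation symmetry, continuity off diagonals and a
factorial × inverse-distance growth bound (for Ising limits: Newman's Gaussian inequality
`⟨σ_A⟩ ≤ Σ_pairings ∏⟨σσ⟩` and `S₂ ≤ C‖x−y‖⁻¹`). -/
def IsOSRegular (S : CorrFamily 3) : Prop :=
  (∀ n (p : Equiv.Perm (Fin n)) (x : Fin n → E3), S n (x ∘ p) = S n x) ∧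
  (∀ n, ContinuousOn (S n) (NonCoincident 3 n)) ∧
  ∃ C : ℝ, ∀ n (x : Fin n → E3), x ∈ NonCoincident 3 n →
    |S n x| ≤ C ^ n * (n.factorial : ℝ) * ∏ i, ∏ j, (if i < j then max 1 (‖x i - x j‖⁻¹) else 1)

/-- (R) support: limits of the critical correlators are OS-regular. -/
def LimitOSRegular : Prop :=
  ∀ (ρ : ℝ → ℝ) (S : CorrFamily 3), (∀ δ ∈ Set.Ioc (0:ℝ) 1, 0 < ρ δ) →
    HasPointwiseScalingLimit (criticalCorr 3) ρ S →
    (∀ n z, z ∉ NonCoincident 3 n → S n z = 0) → IsOSRegular S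

/-- (G) GAUSSIAN ENDPOINT RIGIDITY (Literature-grade theorem, L/XL to formalise): a nine-mirror
reflection-positive, OS-regular, Euclidean-invariant, non-degenerate family that is scale covariant
with the FREE weight `Δ = 1/2 = (d−2)/2` is inversion covariant — indeed it is the massless free
(Wick) family: OS reconstruction, then the zero-mass Jost–Schroer theorem (Pohlmeyer, CMP 12
(1969)) since `S₂ = c‖x−y‖⁻¹` is the free two-point function; Wick families are Möbius covariant. -/
def GaussianEndpointRigidity : Prop :=
  ∀ S : CorrFamily 3, (∀ nrm ∈ mirrorNormals, IsFamilyRP S nrm) → IsOSRegular S →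
    (∀ n z, z ∉ NonCoincident 3 n → S n z = 0) → IsNondegenerateTwoPoint S →
    IsTranslationInvariant S → IsRotationInvariant S → IsScaleCovariant (1 / 2 : ℝ) S →
    IsInversionCovariant (1 / 2 : ℝ) S

/-- (L) LIGHT-WINDOW RIGIDITY — the residual crux of card 2 (the (LowΔ) loophole of the
reflection-positivity barrier, made a statement): the same hypotheses with an INTERACTING weight in
the rigorous Ising window `1/2 < Δ ≤ 1 (< 3/2 = first sharp-time threshold < 5/2 = first scalar
descendant)` force inversion covariance. No counterexample can be a descendant, a Wick polynomial,
a generalised free field or a subsector of a unitary CFT (Dymarsky–Zhiboedov). -/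
def LightWindowRigidity : Prop :=
  ∀ (Δ : ℝ) (S : CorrFamily 3), 1 / 2 < Δ → Δ ≤ 1 →
    (∀ nrm ∈ mirrorNormals, IsFamilyRP S nrm) → IsOSRegular S →
    (∀ n z, z ∉ NonCoincident 3 n → S n z = 0) → IsNondegenerateTwoPoint S →
    IsTranslationInvariant S → IsRotationInvariant S → IsScaleCovariant Δ S →
    IsInversionCovariant Δ S

/-- Card 2 concludes the crux BY NAME, by cases on the proved window `Δ ∈ [1/2, 1]`
(`scalingDimension_mem_Icc_holds`): existence (item 1981) + rotations (items 1979/1980) + RP and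
regularity of limits + (G) ∨ (L). Pure logic. -/
theorem moebiusLimit_of_endpoint_or_window
    (hE : Theses.HyperoctahedralRP.ExistsScaleCovariantLimit)
    (hHRP : Theses.HyperoctahedralRP.HRP2Rigidity)
    (hRot : Theses.HyperoctahedralRP.LimitRotationInvariant)
    (hP : LimitNineMirrorRP) (hR : LimitOSRegular)
    (hG : GaussianEndpointRigidity) (hL : LightWindowRigidity) :
    Theses.EnergyNotSigmaSquared.MoebiusLimit := by
  obtain ⟨ρ, Δ, S, hρ, hΔ, hlim, hnorm, hnd, htr, hsc⟩ := hE
  have hrot : IsRotationInvariant S := hRot hHRP ρ Δ S hρ hlim hnorm hnd htr hsc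
  have hwin : Δ ∈ Set.Icc (1 / 2 : ℝ) 1 := scalingDimension_mem_Icc_holds ρ Δ S hlim hsc hnd hρ
  have hrp : ∀ nrm ∈ mirrorNormals, IsFamilyRP S nrm := hP ρ S hρ hlim hnorm
  have hreg : IsOSRegular S := hR ρ S hρ hlim hnorm
  have hinv : IsInversionCovariant Δ S := by
    rcases eq_or_lt_of_le hwin.1 with h | h
    · subst h
      exact hG S hrp hreg hnorm hnd htr hrot hsc
    · exact hL Δ S h hwin.2 hrp hreg hnorm hnd htr hrot hsc
  exact ⟨ρ, Δ, S, hρ, hΔ, hlim, hnd, ⟨htr, hrot⟩, hsc, hinv⟩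

end Summit.CriticalPhenomena.Ising3DConformalLimit.Cruxes.MoebiusLimitExists.IdeatorK2
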